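import Mathlib
import Literature.Geometry.DiscreteGeometry.TwoShellChartSemantics
import Summits.AtomisticToContinuum.Crystallization.Theorems.NashClassCertificatesNashNearFieldStubLabelledPlacementElim
import Summits.AtomisticToContinuum.Crystallization.Theorems.NashClassCertificatesNashNearFieldStubLabelledPlacementSym

/-!
# Crux `NashClassCertificates.NashNearField` (stmt-AtomisticToContinuum-16827), line `birth`,
# stub `stub_labelledPlacement` — soundness IVb: the DECISION TREE

`runNode` keeps, for the representative carrying the actual labels, a table describing the pivot (eliminations being
contradictions by part III, duplicates transported along the certified table permutation); hence, by induction on the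
fuel, an accepted tree (`checkTree … = true`) yields the leaf goal (`checkTree_sound`): a valid context with the bridge
clauses, and a full assignment of described tables passing the leaf checks.
-/

noncomputable section

open Literature.Geometry.DiscreteGeometry Literature.Geometry.DiscreteGeometry.TwoShellCheck
  Literature.Geometry.DiscreteGeometry.TwoShellChart

namespace Summit.AtomisticToContinuum.Crystallization.Theorems.NashClassCertificatesNashNearField

variable {ι : Type*} {cen : List IVec} {pos : ι → EuclideanSpace ℝ (Fin 3)} {i₀ : ι} {fC : IVec → ι}

/-! ### The decision tree -/

section Tree

variable (W : IVec → PivotW ι) (data : List PivotReps)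

/-- `allIdx f i l`: all indexed tests pass. -/
theorem allIdx_true {α : Type} {f : ℕ → α → Bool} : ∀ (i : ℕ) (l : List α), allIdx f i l = true →
    ∀ k (hk : k < l.length), f (i + k) (l[k]) = true
  | i, [], _, k, hk => by simp at hk
  | i, a :: l, h, k, hk => by
    unfold allIdx at h
    rw [Bool.and_eq_true] at h
    cases k with
    | zero => simpa using h.1
    | succ k =>
      have := allIdx_true (i + 1) l h.2 k (by simpa using hk)
      rw [show i + (k + 1) = i + 1 + k by omega]
      simpa using this

/-- **Soundness of `runNode`** for the representative carrying the actual labels: it is kept (directly or as a duplicate),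
with a table describing the pivot; eliminations are impossible. -/
theorem runNode_sound (hC : CentreGood cen pos i₀ fC) (hW : ∀ v ∈ cen, PivotGood pos (fC v) (W v))
    {p : IVec} (hp : p ∈ cen) {cs : List IVec} (hcs : ∀ c ∈ cs, c ∈ commonsOf cen p)
    {menu : List (ℕ × ℕ × ℕ)} {assigned : List Assigned} (hA : AssignedOK cen pos W assigned)
    {phi : List IVec} (hL : LabelsOK i₀ fC (W p) cs phi) :
    ∀ (reps : List (Bool × List IVec)) (acts : List Action) (kept₀ kept : List (Bool × List Entry)),
      runNode cs p menu assigned reps acts kept₀ = some kept →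
      (∀ x ∈ kept₀, x ∈ kept) ∧
      (((W p).t, phi) ∈ reps → ∃ T, ((W p).t, T) ∈ kept ∧ TableDescribes pos (W p) T)
  | [], [], kept₀, kept, h => by
    simp [runNode] at h; subst h; simp
  | [], _ :: _, kept₀, kept, h => by simp [runNode] at h
  | _ :: _, [], kept₀, kept, h => by
    unfold runNode at h
    simp at h
  | (t, ph) :: reps, a :: acts, kept₀, kept, h => by
    unfold runNode at h
    -- the action result
    cases hra : runAction cs p menu assigned kept₀ t ph a with
    | none => rw [hra] at h; simp at h
    | some r =>
      rw [hra] at h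
      cases r with
      | some T =>
        simp only at h
        obtain ⟨hmono, hact⟩ := runNode_sound hC hW hp hcs hA hL reps acts (kept₀ ++ [(t, T)]) kept h
        refine ⟨fun x hx => hmono x (List.mem_append_left _ hx), fun hmem => ?_⟩
        rcases List.mem_cons.1 hmem with heq | hmem
        · -- the actual representative is kept as a new class: `a = keep`
          simp only [Prod.mk.injEq] at heq
          obtain ⟨rfl, rfl⟩ := heq
          refine ⟨T, hmono _ (List.mem_append_right _ (List.mem_singleton_self _)), ?_⟩
          cases a with
          | keep =>
            simp only [runAction] at hra
            cases hrt : richTable cs phi p (modelList (W p).t) menu with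
            | none => rw [hrt] at hra; simp at hra
            | some T' =>
              rw [hrt] at hra
              simp only [Option.some.injEq] at hra
              rw [← hra]
              exact richTable_describes hC hp (hW p hp) hcs hL hrt
          | elimA wi tr qi =>
            exfalso
            simp only [runAction] at hra
            repeat' (split at hra)
            all_goals simp at hra
          | elimB qi ei trs =>
            exfalso
            simp only [runAction] at hra
            repeat' (split at hra)
            all_goals simp at hra
          | dup k =>
            exfalso
            simp only [runAction] at hra
            repeat' (split at hra)
            all_goals simp at hra
        · exact hact hmem
      | none =>
        simp only at h
        obtain ⟨hmono, hact⟩ := runNode_sound hC hW hp hcs hA hL reps acts kept₀ kept h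
        refine ⟨hmono, fun hmem => ?_⟩
        rcases List.mem_cons.1 hmem with heq | hmem
        · simp only [Prod.mk.injEq] at heq
          obtain ⟨rfl, rfl⟩ := heq
          -- `a` is an elimination (contradiction) or a duplicate (kept earlier)
          cases a with
          | keep =>
            exfalso
            simp only [runAction] at hra
            split at hra <;> simp at hra
          | elimA wi tr qi =>
            exfalso
            simp only [runAction] at hra
            cases hw : (modelList (W p).t)[wi]? with
            | none => simp [hw] at hra
            | some w =>
            cases hq : assigned[qi]? with
            | none => simp [hw, hq] at hra
            | some q =>
              simp only [hw, hq] at hra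
              cases hpl : placeLabel cs phi p tr w with
              | none => simp [hpl] at hra
              | some e =>
                simp only [hpl] at hra
                split_ifs at hra with hel
                obtain ⟨hq1, hqt, hqT⟩ := hA q (List.mem_of_getElem? hq)
                have hb := placeLabel_sound hC hp (hW p hp) hcs hL (List.mem_of_getElem? hw) hpl
                have hqT' : TableDescribes pos (W q.1) q.2.2 := hqT
                exact elimA_false hC hq1 (hW q.1 hq1) hqT' hb hel
          | elimB qi ei trs =>
            exfalso
            simp only [runAction] at hra
            cases hq : assigned[qi]? with
            | none => simp [hq] at hra
            | some q =>
              simp only [hq] at hra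
              cases he : q.2.2[ei]? with
              | none => simp [he] at hra
              | some e =>
                simp only [he] at hra
                split_ifs at hra with hcond
                simp only [Bool.and_eq_true, beq_iff_eq] at hcond
                obtain ⟨⟨hri, hlen⟩, hall⟩ := hcond
                obtain ⟨hq1, hqt, hqT⟩ := hA q (List.mem_of_getElem? hq)
                exact elimB_false hC hp (hW p hp) hqT (List.mem_of_getElem? he) hri hcs hL hlen hall
          | dup k =>
            simp only [runAction] at hra
            cases hk : kept₀[k]? with
            | none => simp [hk] at hra
            | some kT =>
            cases hrt : richTable cs phi p (modelList (W p).t) menu with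
            | none => simp [hk, hrt] at hra
            | some T =>
              simp only [hk, hrt] at hra
              split_ifs at hra with hcond
              simp only [Bool.and_eq_true, beq_iff_eq] at hcond
              obtain ⟨hkt, hperm⟩ := hcond
              refine ⟨kT.2, hmono _ ?_, ?_⟩
              · have : kT = ((W p).t, kT.2) := by rw [← hkt]
                rw [← this]; exact List.mem_of_getElem? hk
              · exact tableDescribes_of_perm (richTable_describes hC hp (hW p hp) hcs hL hrt) (tablePerm_perm hperm)
        · exact hact hmem

/-- The pivots of `assigned`, being distinct points of `cen` and as many as `cen`, are all of `cen`. -/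
theorem cover_of_length (hcen : cen.Nodup) {assigned : List Assigned} (hsub : ∀ a ∈ assigned, a.1 ∈ cen)
    (hnd : (assigned.map fun a => a.1).Nodup) (hlen : assigned.length = cen.length) :
    ∀ v ∈ cen, ∃ a ∈ assigned, a.1 = v := by
  classical
  intro v hv
  have hsub' : (assigned.map fun a => a.1).toFinset ⊆ cen.toFinset := by
    intro z hz
    rw [List.mem_toFinset] at hz ⊢
    obtain ⟨a, ha, rfl⟩ := List.mem_map.1 hz
    exact hsub a ha
  have hcard : cen.toFinset.card ≤ (assigned.map fun a => a.1).toFinset.card := by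
    rw [List.toFinset_card_of_nodup hcen, List.toFinset_card_of_nodup hnd, List.length_map, hlen]
  have heq := Finset.eq_of_subset_of_card_le hsub' hcard
  have : v ∈ (assigned.map fun a => a.1).toFinset := by rw [heq, List.mem_toFinset]; exact hv
  rw [List.mem_toFinset] at this
  obtain ⟨a, ha, rfl⟩ := List.mem_map.1 this
  exact ⟨a, ha, rfl⟩

/-- **Soundness of the tree checker.** -/
theorem checkTree_sound (hC : CentreGood cen pos i₀ fC) (hcen : cen.Nodup) (h0 : ((0 : ℤ), (0 : ℤ), (0 : ℤ)) ∉ cen)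
    (hW : ∀ v ∈ cen, PivotGood pos (fC v) (W v))
    (hrep : ∀ v ∈ cen, ∀ cs reps, repsOf data v = some (cs, reps) →
      ∃ phi, ((W v).t, phi) ∈ reps ∧ LabelsOK i₀ fC (W v) cs phi) :
    ∀ (fuel : ℕ) (assigned : List Assigned) (cert : Cert), checkTree cen data fuel assigned cert = true →
      AssignedOK cen pos W assigned → (assigned.map fun a => a.1).Nodup → LeafGoal cen pos W
  | 0, assigned, cert, h, _, _ => by simp [checkTree] at h
  | fuel + 1, assigned, .leaf κ wits witI, h, hA, hnd => by
    unfold checkTree at h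
    simp only [Bool.and_eq_true, beq_iff_eq] at h
    obtain ⟨⟨⟨⟨hvalid, hlen⟩, hwl⟩, hall⟩, hbr⟩ := h
    exact ⟨κ, assigned, wits, witI, hvalid, hbr, hwl, hall, hA,
      cover_of_length hcen (fun a ha => (hA a ha).1) hnd hlen⟩
  | fuel + 1, assigned, .node p menu acts subs, h, hA, hnd => by
    unfold checkTree at h
    simp only [Bool.and_eq_true, Bool.not_eq_true'] at h
    obtain ⟨⟨hpm, hnot⟩, hrest⟩ := h
    have hp : p ∈ cen := by
      unfold lmem at hpm
      obtain ⟨q, hq, hqe⟩ := List.any_eq_true.1 hpm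
      obtain ⟨a, b, c⟩ := q; obtain ⟨a', b', c'⟩ := p
      simp only [veq, Bool.and_eq_true, beq_iff_eq] at hqe
      rw [← hqe.1.1, ← hqe.1.2, ← hqe.2]; exact hq
    have hpnot : ∀ a ∈ assigned, a.1 ≠ p := by
      intro a ha heq
      have : (assigned.any fun q => veq q.1 p) = true := by
        rw [List.any_eq_true]
        refine ⟨a, ha, ?_⟩
        rw [heq]
        obtain ⟨a', b', c'⟩ := p
        simp [veq]
      rw [this] at hnot
      exact Bool.noConfusion hnot
    cases hro : repsOf data p with
    | none => rw [hro] at hrest; simp at hrest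
    | some csreps =>
      obtain ⟨cs, reps⟩ := csreps
      rw [hro] at hrest
      simp only [Bool.and_eq_true] at hrest
      obtain ⟨hiv, hrest⟩ := hrest
      obtain ⟨hcs, -⟩ := commons_of_ivPerm hcen h0 hiv
      cases hrn : runNode cs p menu assigned reps acts [] with
      | none => rw [hrn] at hrest; simp at hrest
      | some kept =>
        rw [hrn] at hrest
        simp only [Bool.and_eq_true, beq_iff_eq] at hrest
        obtain ⟨hklen, hidx⟩ := hrest
        obtain ⟨phi, hphi, hL⟩ := hrep p hp cs reps hro
        obtain ⟨-, hact⟩ := runNode_sound W hC hW hp hcs hA hL reps acts [] kept hrn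
        obtain ⟨T, hT, hdesc⟩ := hact hphi
        obtain ⟨i, hi, hiT⟩ := List.mem_iff_getElem.1 hT
        have hsub := allIdx_true 0 kept hidx i hi
        rw [zero_add] at hsub
        cases hsi : subs[i]? with
        | none => rw [hsi] at hsub; simp at hsub
        | some c =>
          rw [hsi] at hsub
          simp only at hsub
          rw [hiT] at hsub
          refine checkTree_sound hC hcen h0 hW hrep fuel _ c hsub ?_ ?_
          · intro a ha
            rcases List.mem_append.1 ha with ha | ha
            · exact hA a ha
            · rw [List.mem_singleton] at ha
              subst ha
              exact ⟨hp, rfl, hdesc⟩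
          · rw [List.map_append, List.nodup_append]
            refine ⟨hnd, by simp, ?_⟩
            intro z hz z' hz'
            simp only [List.map_cons, List.map_nil, List.mem_singleton] at hz'
            subst hz'
            obtain ⟨a, ha, rfl⟩ := List.mem_map.1 hz
            exact hpnot a ha

end Tree

/-- **Registered sub-goal `stub_labelledPlacementAllIdx` of crux stmt-AtomisticToContinuum-16827** (landing anchor of this file,
re-exporting `allIdx_true`). -/
theorem stub_labelledPlacementAllIdx : ∀ (f : ℕ → ℤ → Bool) (i : ℕ) (l : List ℤ), Literature.Geometry.DiscreteGeometry.TwoShellChart.allIdx f i l = true → ∀ (k : ℕ) (hk : k < l.length), f (i + k) (l[k]) = true :=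
  fun _ i l h k hk => allIdx_true i l h k hk

end Summit.AtomisticToContinuum.Crystallization.Theorems.NashClassCertificatesNashNearField

end
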